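import Literature.NumberTheory.EllipticCurves.IwasawaSelmerControlLocalizationProofs
import Literature.NumberTheory.GaloisRepresentations.AbsGaloisGroupCompact
import HarnessLib

/-!
# The LOCAL `ℤ_p`-extension at a place that does not split completely: `Γ_{K_v} ↠ ℤ_p` with kernel
# `Gal(K̄_v/K_∞·K_v)` and a topological generator (cell `b2b-bsdres`, CLASS-CLOSURE lane, class O10
# — x1b GEN 35, class lead; file 51 of the series: brick B4 of the GLOBAL count (C), part 2 — the
# device that turns local-tower questions at `v` into `ZpExtension` questions over `K_v`)

HONEST FRAMING (cell `b2b-bsdres`, run/shared/lean/b2b/bsd-rank1-residual/, verbatim in every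
file): the goal of the cell is to DELETE the COMBINATION-SHAPED residual classes of the
Birch–Swinnerton-Dyer formula for ALL analytic-rank `≤ 1` elliptic curves over `ℚ` — "full BSD
formula for every rank `≤ 1` curve in class `C`" assembled STRICTLY from published theorems — so
that the rank-`≤ 1` remainder becomes exactly the CONSTRUCTION-SHAPED classes, which are TYPED
(missing-input `Prop`s), NOT attempted. This is not "finishing BSD". CLASS-CLOSURE lane: prove
what is provable now; shrink each hard class to its core with data; no claim beyond stated classes;
research routes on CONSTRUCTION-SHAPED X12 / O10; census / instrument output = EVIDENCE / conjecture
items, NEVER a Literature fact; `RESIDUAL-MAP.md` marks change only by signed lines. THIS FILE: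
ONE TOOL THEOREM (an existence statement over the tree's `ZpExtension` / `localSubgroup`
vocabulary; the witness is built inside the proof) — no definition, no named Literature fact, no
Summits-side fact `def … : Prop`, no `sorry`, axioms standard; nothing is booked; no label / mark /
count / sub-cell moves; O10 stays OPEN / CONSTRUCTION-SHAPED; nothing about `BSD(W, p)` of any pair
is claimed.

## What (brick B4 of `B2-LOCALISATION-x1b.md` §3, step (ii): the device)

For a `ℤ_p`-extension `κ : Γ_K ↠ ℤ_p` and a `K`-field `E` (a completion `K_v`) whose restriction
`Γ_E → Γ_K` does NOT land in `ker κ` (the place does not split completely in `K_∞/K`), the image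
of `Γ_E` under `κ ∘ res` is a non-zero closed subgroup `pᵐℤ_p` of `ℤ_p`; rescaling by a generator
`x₀ = κ(res g)` of maximal norm gives a SURJECTIVE continuous homomorphism
`κ_E = x₀⁻¹·(κ ∘ res) : Γ_E ↠ ℤ_p`, i.e. a `ZpExtension E p`, with
`ker κ_E = (Γ_E → Γ_K)⁻¹(ker κ) = Gal(K̄_E/K_∞·E)` (`localSubgroup κ.kerSubgroup E`) and topological
generator `g` (`κ_E g = 1`). **`exists_localZpExtension`**. Consequence: every tree theorem about
`ℤ_p`-extensions of a field (`kerLayerToInftyEquiv`, `exists_cocycle_vanishing_apply_eq`,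
`layerSubgroup_eq_top_of_isOpen`, …) applies to the local tower `K_{v,∞} = K_∞·K_v / K_v`; this is how
Greenberg treats `Γ_v = Gal(K_{v,∞}/K_v) ≅ ℤ_p` in LNM 1716 §3 (Lemmas 3.3–3.4: "`K_η` is the
unramified `ℤ_p`-extension of `F_v`", p. 87) and how the surjectivity half of
`𝒦_{v,0}[p^∞] ≅ B/(γ_v − 1)B` (B4 step (ii)) is to be obtained.

References: [GreenbergLNM1716] R. Greenberg, LNM 1716 (1999), §3 pp. 86–88; [Washington1997] §13.1
(closed subgroups of `ℤ_p`); [SerreGaloisCohomology1997] II.§1.1.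
-/

noncomputable section

open scoped Classical

universe u

namespace Summit.BirchSwinnertonDyer.Rank1Residual.Additive

open Literature.NumberTheory.EllipticCurves Literature.NumberTheory.GaloisRepresentations ZpExtension

variable {K : Type u} [Field K] {p : ℕ} [hp : Fact p.Prime] (κ : ZpExtension K p)
  (E : Type u) [Field E] [Algebra K E]

/-- **The local `ℤ_p`-extension at a non-split place.** If some `δ ∈ Γ_E` restricts outside
`ker κ`, there is a `ℤ_p`-extension `κ_E` of `E` whose kernel is `Gal(K̄_E/K_∞·E) = res⁻¹(ker κ)`
and which has a topological generator `g ∈ Γ_E` (`κ_E g = 1`); moreover `κ_E` is `κ ∘ res`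
rescaled: `κ(res σ) = κ_E(σ) · κ(res g)` (additively) for all `σ`. Construction: `x₀ = κ(res g)` of
MAXIMAL norm over the compact `Γ_E` (`IsCompact.exists_isMaxOn`); then `κ(res σ)/x₀ ∈ ℤ_p` for all
`σ`, the rescaled map is a continuous homomorphism with `g ↦ 1`, and its image is a closed subgroup
of `ℤ_p` containing `ℤ`, hence everything (`PadicInt.denseRange_intCast`).
[cite: GreenbergLNM1716, §3 p. 87] [cite: Washington1997, §13.1] -/
theorem exists_localZpExtension
    (hE : ∃ δ : Field.absoluteGaloisGroup E, resGal (K := K) E δ ∉ κ.kerSubgroup) :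
    ∃ (κE : ZpExtension E p) (g : Field.absoluteGaloisGroup E),
      κE.kerSubgroup = localSubgroup κ.kerSubgroup E ∧ κE.IsTopGenerator g ∧
        ∀ σ : Field.absoluteGaloisGroup E,
          (κ (resGal (K := K) E σ)).toAdd = (κE σ).toAdd * (κ (resGal (K := K) E g)).toAdd := by
  haveI : CompactSpace (Field.absoluteGaloisGroup E) := absoluteGaloisGroup_compactSpace E
  -- the additive coordinate `a σ = κ(res σ) ∈ ℤ_p` and its norm
  let a : Field.absoluteGaloisGroup E → ℤ_[p] := fun σ ↦ (κ (resGal (K := K) E σ)).toAdd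
  have ha_cont : Continuous a :=
    continuous_toAdd.comp ((map_continuous κ).comp (map_continuous (resGal (K := K) E)))
  have ha_mul : ∀ σ τ, a (σ * τ) = a σ + a τ := fun σ τ ↦ by
    simp only [a, map_mul, toAdd_mul]
  have ha_one : a 1 = 0 := by simp only [a, map_one, toAdd_one]
  have ha_inv : ∀ σ, a σ⁻¹ = -a σ := fun σ ↦ by
    have h := ha_mul σ σ⁻¹
    rw [mul_inv_cancel, ha_one] at h
    linear_combination -h
  -- an element `g` of maximal norm
  obtain ⟨g, -, hg⟩ := (isCompact_univ (X := Field.absoluteGaloisGroup E)).exists_isMaxOn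
    Set.univ_nonempty ((continuous_norm.comp ha_cont).continuousOn)
  have hmax : ∀ σ, ‖a σ‖ ≤ ‖a g‖ := fun σ ↦ hg (Set.mem_univ σ)
  set x₀ : ℤ_[p] := a g with hx₀def
  have hx₀ : x₀ ≠ 0 := by
    obtain ⟨δ, hδ⟩ := hE
    intro h0
    have hδ0 : a δ ≠ 0 := fun h ↦ hδ (by
      rw [ZpExtension.mem_kerSubgroup]
      exact Multiplicative.toAdd.injective (by rw [toAdd_one]; exact h))
    have := hmax δ
    rw [h0, norm_zero] at this
    exact hδ0 (norm_le_zero_iff.mp this)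
  have hx₀' : (x₀ : ℚ_[p]) ≠ 0 := PadicInt.coe_ne_zero.mpr hx₀
  -- the rescaled coordinate `y σ = a σ / x₀ ∈ ℤ_p`
  have hnorm : ∀ σ, ‖(a σ : ℚ_[p]) / (x₀ : ℚ_[p])‖ ≤ 1 := fun σ ↦ by
    rw [norm_div, PadicInt.padic_norm_e_of_padicInt, PadicInt.padic_norm_e_of_padicInt]
    exact div_le_one_of_le₀ (hmax σ) (norm_nonneg _)
  let y : Field.absoluteGaloisGroup E → ℤ_[p] := fun σ ↦ ⟨(a σ : ℚ_[p]) / (x₀ : ℚ_[p]), hnorm σ⟩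
  have hy_coe : ∀ σ, ((y σ : ℤ_[p]) : ℚ_[p]) = (a σ : ℚ_[p]) / (x₀ : ℚ_[p]) := fun _ ↦ rfl
  have hy_mul : ∀ σ τ, y (σ * τ) = y σ + y τ := fun σ τ ↦ by
    apply Subtype.ext
    change (a (σ * τ) : ℚ_[p]) / (x₀ : ℚ_[p]) = (a σ : ℚ_[p]) / x₀ + (a τ : ℚ_[p]) / x₀
    rw [ha_mul, PadicInt.coe_add, add_div]
  have hy_one : y 1 = 0 := by
    apply Subtype.ext
    change (a 1 : ℚ_[p]) / (x₀ : ℚ_[p]) = 0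
    rw [ha_one, PadicInt.coe_zero, zero_div]
  have hy_g : y g = 1 := by
    apply Subtype.ext
    change (a g : ℚ_[p]) / (x₀ : ℚ_[p]) = 1
    rw [← hx₀def, div_self hx₀']
  have hy_cont : Continuous y :=
    ((continuous_subtype_val.comp ha_cont).div_const _).subtype_mk _
  have hy_x₀ : ∀ σ, a σ = y σ * x₀ := fun σ ↦ by
    apply Subtype.ext
    rw [PadicInt.coe_mul]
    change (a σ : ℚ_[p]) = (a σ : ℚ_[p]) / x₀ * x₀
    rw [div_mul_cancel₀ _ hx₀']
  -- the rescaled continuous homomorphism `Γ_E →ₜ* ℤ_p`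
  let φ : Field.absoluteGaloisGroup E →ₜ* Multiplicative ℤ_[p] :=
    { toFun := fun σ ↦ Multiplicative.ofAdd (y σ)
      map_one' := by rw [hy_one, ofAdd_zero]
      map_mul' := fun σ τ ↦ by rw [hy_mul, ofAdd_add]
      continuous_toFun := continuous_ofAdd.comp hy_cont }
  have hφ : ∀ σ, φ σ = Multiplicative.ofAdd (y σ) := fun _ ↦ rfl
  have hφg : φ g = Multiplicative.ofAdd 1 := by rw [hφ, hy_g]
  -- surjectivity: the image is a closed subgroup of `ℤ_p` containing `ℤ`
  have hsurj : Function.Surjective φ := by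
    have hclosed : IsClosed (Set.range φ) := (isCompact_range φ.continuous_toFun).isClosed
    have hsub : Set.range (fun n : ℤ ↦ Multiplicative.ofAdd ((n : ℤ) : ℤ_[p])) ⊆ Set.range φ := by
      rintro _ ⟨n, rfl⟩
      refine ⟨g ^ n, ?_⟩
      rw [map_zpow, hφg, ← ofAdd_zsmul, zsmul_eq_mul, mul_one]
    have hdense : DenseRange (fun n : ℤ ↦ Multiplicative.ofAdd ((n : ℤ) : ℤ_[p])) :=
      (Multiplicative.ofAdd.surjective.denseRange).comp PadicInt.denseRange_intCast continuous_ofAdd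
    have huniv : Set.range φ = Set.univ := by
      have hd : Dense (Set.range φ) := hdense.mono hsub
      rw [← hclosed.closure_eq, hd.closure_eq]
    intro x
    have hx : x ∈ Set.range φ := by rw [huniv]; exact Set.mem_univ x
    exact hx
  refine ⟨⟨φ, hsurj⟩, g, ?_, hφg, fun σ ↦ hy_x₀ σ⟩
  -- the kernel is `res⁻¹(ker κ)`
  ext σ
  rw [ZpExtension.mem_kerSubgroup, mem_localSubgroup_iff, ZpExtension.mem_kerSubgroup]
  change φ σ = 1 ↔ _
  rw [hφ]
  constructor
  · intro h
    have hy0 : y σ = 0 := Multiplicative.ofAdd.injective (by rw [h, ofAdd_zero])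
    have ha0 : a σ = 0 := by rw [hy_x₀ σ, hy0, zero_mul]
    exact Multiplicative.toAdd.injective (by rw [toAdd_one]; exact ha0)
  · intro h
    have ha0 : a σ = 0 := by
      change (κ (resGal (K := K) E σ)).toAdd = 0
      rw [h, toAdd_one]
    have hy0 : y σ = 0 := by
      apply Subtype.ext
      change (a σ : ℚ_[p]) / (x₀ : ℚ_[p]) = 0
      rw [ha0, PadicInt.coe_zero, zero_div]
    rw [hy0, ofAdd_zero]

end Summit.BirchSwinnertonDyer.Rank1Residual.Additive

end
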